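import Summits.BirchSwinnertonDyer.BirchSwinnertonDyer.Theorems.InertBadSignedBranchesInertBadAtThreeQuarticCleanAssemblyOdd
import Summits.BirchSwinnertonDyer.BirchSwinnertonDyer.Theorems.InertBadSignedBranchesInertBadAtThreeQuarticTorsionIntegrality
import Summits.BirchSwinnertonDyer.BirchSwinnertonDyer.Theorems.InertBadSignedBranchesInertBadAtThreeQuarticModelPeriods
import Summits.BirchSwinnertonDyer.BirchSwinnertonDyer.Theorems.InertBadSignedBranchesInertBadAtThreeQuarticModel
import Summits.BirchSwinnertonDyer.BirchSwinnertonDyer.Theorems.EdixhovenFibreFiveSevenStarredOptimalManinUnitFiveSevenValueExit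
import Mathlib.NumberTheory.GaussSum
import Mathlib.NumberTheory.DirichletCharacter.Basic
import Mathlib.NumberTheory.LSeries.Basic
import HarnessLib

/-!
# STUB-PLAN P6 (assembly), part C — the EVEN branch: `f`-free even twisted-value statement for the quartic models
# `y² = x³ + Ax` from the theta dictionary (real period `Ω⁺`)

Summit `BirchSwinnertonDyer`, crux `InertBadAtThree` (stmt-BirchSwinnertonDyer-19225), line of record
`Cruxes/InertBadAtThree/Lines/rubin_e1_inert_three.lean` v5 (lead `bsd-line-ibd-p1`). The v5 registered stub
`stub_plainOddNeronIntegralThreeQuartic` needs only the ODD branch (Part B, `…QuarticCleanAssemblyOdd`); this twin gives the EVEN branch,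
so that the v4 statement C⁺_quartic (`NeronIntegralThreeQuartic` = F-es-18's body on the whole quartic cell, both parities, every modulus
prime to `3`; consumers: crux 22968's `kato_shift_three` debt, K8 child 19657) also follows from the theta dictionary P1b via
`…QuarticValueExit.neronIntegralThreeQuartic_of_LValues` + `…QuarticModel.LValueEven_of_quarticModel`. Lead bsd-line-ibd-p1 g7
(`--supports 19225`, helper).

* `exists_realPeriodRat_quartic` — `Ω⁺(⟨0,0,0,A,0⟩) = c·ϖ₀·|A|^{−1/4}` with `c ∈ {2, √2}` (bed-w3 g8's
  `…QuarticModelPeriods.realPeriodRat_quartic_of_neg/_pos`), so `2/c ∈ {1, √2}` is an algebraic integer;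
* ★ `evenLValue_quartic_of_dictionary` — same hypotheses as the odd theorem; conclusion with `Ω⁺(E_A)` and no `i`:
  `s·τ(χ)·L(1)/Ω⁺(E_A) ∈ ℤ̄`, `3 ∤ s`, `L = ¼ Θ-L_{3M'}(conj(q)^k Ψ')`.

HONEST FRAMING: conditional on the dictionary hypothesis; nothing here proves the stub, the crux or BSD. No definitions, no named
facts, no `sorry`; axioms standard.
-/

set_option linter.dupNamespace false
set_option autoImplicit false

noncomputable section

open scoped ComplexConjugate
open Complex PeriodPair
open Literature.NumberTheory.EllipticCurves Literature.NumberTheory.EllipticCurves.GaussianLattice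
open Literature.NumberTheory.LFunctions Literature.NumberTheory.LFunctions.GaussianTheta

namespace Summit.BirchSwinnertonDyer.BirchSwinnertonDyer.Theorems.InertBadSignedBranchesInertBadAtThreeQuarticCleanAssembly

/-- The real period of the model: `Ω⁺(⟨0,0,0,A,0⟩) = c · ϖ₀ · |A|^{−1/4}` with `c ∈ {2, √2}`, so `2/c` is an algebraic
integer (`…QuarticModelPeriods`). [cite: SilvermanAEC2009, Thm VI.5.1 and C.16] -/
theorem exists_realPeriodRat_quartic {A : ℤ} (hA : A ≠ 0) :
    ∃ c : ℝ, c ≠ 0 ∧ IsIntegral ℤ ((2 : ℂ) / (c : ℂ)) ∧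
      (⟨0, 0, 0, (A : ℚ), 0⟩ : WeierstrassCurve ℚ).realPeriodRat =
        c * ((Real.Gamma (1 / 4) ^ 2 / (2 * Real.sqrt (2 * Real.pi))) * |(A : ℝ)| ^ (-(1 / 4 : ℝ))) := by
  rcases lt_or_gt_of_ne hA with h | h
  · refine ⟨2, two_ne_zero, ?_, InertBadSignedBranchesInertBadAtThreeQuarticModelPeriods.realPeriodRat_quartic_of_neg A h⟩
    rw [Complex.ofReal_ofNat, div_self two_ne_zero]; exact isIntegral_one
  · refine ⟨Real.sqrt 2, (Real.sqrt_pos.mpr two_pos).ne', ?_,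
      InertBadSignedBranchesInertBadAtThreeQuarticModelPeriods.realPeriodRat_quartic_of_pos A h⟩
    have h2 : (2 : ℂ) / (Real.sqrt 2 : ℝ) = (Real.sqrt 2 : ℝ) := by
      have hs : ((Real.sqrt 2 : ℝ) : ℂ) ^ 2 = 2 := by rw [← Complex.ofReal_pow, Real.sq_sqrt (by norm_num)]; push_cast; ring
      have hs0 : ((Real.sqrt 2 : ℝ) : ℂ) ≠ 0 := Complex.ofReal_ne_zero.mpr (Real.sqrt_pos.mpr two_pos).ne'
      field_simp
      linear_combination (-1 : ℂ) * hs
    rw [h2]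
    exact isIntegral_sqrt_two

variable {q : GaussianInt → ℂ}
  (hq : ∀ x : GaussianInt, q x =
    if (3 : ℤ) ∣ x.re ∧ (3 : ℤ) ∣ x.im then 0
    else if (3 : ℤ) ∣ x.im then 1
    else if (3 : ℤ) ∣ x.re then -1
    else if (3 : ℤ) ∣ x.re - x.im then -I
    else I)

include hq

/-- ★ **STUB-PLAN P6, EVEN branch, for the model `E_A : y² = x³ + Ax`.** Let `1 ≤ k ≤ 3` with `3^k ∣ A`, `(3, M') = 1`, `Ψ'` periodic
modulo `M'` with algebraic-integer values, and suppose the THETA DICTIONARY (P1b): for `re s > 2`,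
`Σ χ̄(n) a_n(E_A) n⁻ˢ = ¼ · Θ-L_{3M'}(conj(χ₄)^k · Ψ')(s)` (`χ₄ = (·/3)₄`, hypothesis shape `hq`). Then the `f`-free even statement of
`…QuarticValueExit` holds for `E_A` at `p = 3`: the entire continuation `L = ¼ Θ-L` satisfies `s·τ(χ)·L(1)/Ω⁺(E_A) ∈ ℤ̄` for some
`3 ∤ s`. Bookkeeping: `L(1) = (12M')⁻¹ Σ_b Ψ'(b) R_k(w_b)` (§6), `R_k(w_b)/(ϖ₀3^{(4−k)/4})` is `3`-integral (§5),
`Ω⁺(E_A) = cϖ₀|A|^{−1/4}` and `|A|^{1/4} = 3^{k/4}A₁^{1/4}`: the powers of `3` cancel exactly (`3^{k/4}·3^{(4−k)/4} = 3` against `1/3`).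
[cite: Rubin1999, Prop. 7.15] [cite: MazurTateTeitelbaum1986, §I.8 (8.6)] -/
theorem evenLValue_quartic_of_dictionary (A : ℤ) (hA : A ≠ 0) {k : ℕ} (hk1 : 1 ≤ k) (hk3 : k ≤ 3) (hkA : 3 ^ k ∣ A.natAbs)
    {m : ℕ} [NeZero m] (χ : DirichletCharacter ℂ m) {M' : ℕ} [NeZero M'] [NeZero (3 * M')] (h3 : Nat.Coprime 3 M')
    (Ψ : GaussianInt → ℂ) (hΨ : ∀ x y : GaussianInt, Ψ (x + M' * y) = Ψ x) (hΨint : ∀ x : GaussianInt, IsIntegral ℤ (Ψ x))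
    (hdict : ∀ s : ℂ, 2 < s.re →
      LSeries (fun n : ℕ ↦ χ⁻¹ (n : ZMod m) * ((⟨0, 0, 0, (A : ℚ), 0⟩ : WeierstrassCurve ℚ).LFunction n : ℂ)) s =
        (1 / 4 : ℂ) * thetaLFunction (3 * M') (fun x ↦ (conj (q x)) ^ k * Ψ x) s) :
    ∃ L : ℂ → ℂ, Differentiable ℂ L ∧
      (∀ s : ℂ, 2 < s.re →
        L s = LSeries (fun n : ℕ ↦ χ⁻¹ (n : ZMod m) * ((⟨0, 0, 0, (A : ℚ), 0⟩ : WeierstrassCurve ℚ).LFunction n : ℂ)) s) ∧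
      ∃ s : ℕ, ¬ 3 ∣ s ∧ IsIntegral ℤ ((s : ℂ) * (gaussSum χ (ZMod.stdAddChar (N := m)) * L 1 /
        ((⟨0, 0, 0, (A : ℚ), 0⟩ : WeierstrassCurve ℚ).realPeriodRat : ℂ))) := by
  -- Bezout for `(3, M')`
  have h3' : ¬ 3 ∣ M' := fun h ↦ by
    have h1 : 3 ∣ Nat.gcd 3 M' := Nat.dvd_gcd (dvd_refl 3) h
    rw [h3] at h1
    omega
  obtain ⟨α, β, hαβ⟩ : ∃ α β : ℤ, α * M' + 3 * β = 1 := by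
    have hcop : IsCoprime (M' : ℤ) (3 : ℤ) := by
      rw [Int.isCoprime_iff_gcd_eq_one, show (3 : ℤ) = ((3 : ℕ) : ℤ) by rfl, Int.gcd_natCast_natCast]; exact h3.symm
    obtain ⟨u, v, huv⟩ := hcop
    exact ⟨u, v, by linear_combination huv⟩
  have hk0 : k ≠ 0 := by omega
  refine ⟨fun s ↦ (1 / 4 : ℂ) * thetaLFunction (3 * M') (fun x ↦ (conj (q x)) ^ k * Ψ x) s,
    (differentiable_thetaLFunction (3 * M') _).const_mul _, fun s hs ↦ (hdict s hs).symm, ?_⟩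
  -- the regrouped sum and its `3`-integrality
  obtain ⟨s₀, hs₀, hX⟩ := sum_torsion_threeIntegral hk1 hk3 h3' β Ψ hΨint
  set T : ℂ := ∑ b : ZMod M' × ZMod M', Ψ (rep M' b 0) *
        ((kroneckerE₁ ((β : ℂ) * conj ((rep M' b 0 : GaussianInt) : ℂ) / M' + 1 / 3) +
            kroneckerE₁ ((β : ℂ) * conj ((rep M' b 0 : GaussianInt) : ℂ) / M' - 1 / 3)) +
          (-1 : ℂ) ^ k * (kroneckerE₁ ((β : ℂ) * conj ((rep M' b 0 : GaussianInt) : ℂ) / M' + I / 3) +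
            kroneckerE₁ ((β : ℂ) * conj ((rep M' b 0 : GaussianInt) : ℂ) / M' - I / 3)) +
          I ^ k * (kroneckerE₁ ((β : ℂ) * conj ((rep M' b 0 : GaussianInt) : ℂ) / M' + (1 - I) / 3) +
            kroneckerE₁ ((β : ℂ) * conj ((rep M' b 0 : GaussianInt) : ℂ) / M' - (1 - I) / 3)) +
          (-I) ^ k * (kroneckerE₁ ((β : ℂ) * conj ((rep M' b 0 : GaussianInt) : ℂ) / M' + (1 + I) / 3) +
            kroneckerE₁ ((β : ℂ) * conj ((rep M' b 0 : GaussianInt) : ℂ) / M' - (1 + I) / 3))) with hT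
  have hL1 : (1 / 4 : ℂ) * thetaLFunction (3 * M') (fun x ↦ (conj (q x)) ^ k * Ψ x) 1 = (1 / 4 : ℂ) * (((3 * M' : ℕ) : ℂ)⁻¹ * T) := by
    rw [thetaLFunction_one_eq_sum_torsion hq h3 hαβ Ψ hΨ hk0]
  -- the period
  obtain ⟨c, hc0, hcint, hΩ⟩ := exists_realPeriodRat_quartic hA
  obtain ⟨A₁, hA₁⟩ := hkA
  have hA₁0 : A₁ ≠ 0 := by
    rintro rfl
    rw [mul_zero, Int.natAbs_eq_zero] at hA₁
    exact hA hA₁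
  have hinv := inv_abs_rpow_neg_quarter hA₁
  have hXpos : 0 < |(A : ℝ)| ^ (-(1 / 4 : ℝ)) := Real.rpow_pos_of_pos (abs_pos.mpr (by exact_mod_cast hA)) _
  have hX' : ((((|(A : ℝ)| ^ (-(1 / 4 : ℝ)) : ℝ)) : ℂ)) =
      ((3 : ℂ) ^ ((k : ℂ) / 4) * ((((A₁ : ℝ) ^ (1 / 4 : ℝ) : ℝ)) : ℂ))⁻¹ := by rw [← hinv, inv_inv]
  refine ⟨8 * M' * s₀, ?_, ?_⟩
  · intro h
    rcases (Nat.Prime.dvd_mul Nat.prime_three).mp h with h | h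
    · rcases (Nat.Prime.dvd_mul Nat.prime_three).mp h with h | h
      · omega
      · exact h3' h
    · exact hs₀ h
  show IsIntegral ℤ (((8 * M' * s₀ : ℕ) : ℂ) * (gaussSum χ (ZMod.stdAddChar (N := m)) *
    ((1 / 4 : ℂ) * thetaLFunction (3 * M') (fun x ↦ (conj (q x)) ^ k * Ψ x) 1) /
      ((⟨0, 0, 0, (A : ℚ), 0⟩ : WeierstrassCurve ℚ).realPeriodRat : ℂ)))
  rw [hL1, hΩ, Complex.ofReal_mul, Complex.ofReal_mul, hX']
  set ϖ : ℂ := (((Real.Gamma (1 / 4) ^ 2 / (2 * Real.sqrt (2 * Real.pi))) : ℝ) : ℂ) with hϖ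
  set ρ : ℂ := (3 : ℂ) ^ (((4 - k : ℕ) : ℂ) / 4) with hρ
  set t : ℂ := (3 : ℂ) ^ ((k : ℂ) / 4) with ht
  set a : ℂ := ((((A₁ : ℝ) ^ (1 / 4 : ℝ) : ℝ)) : ℂ) with ha
  set τ : ℂ := gaussSum χ (ZMod.stdAddChar (N := m)) with hτ
  have hϖ0 : ϖ ≠ 0 := Complex.ofReal_ne_zero.mpr GaussianLattice.varpi_pos.ne'
  have hρ0 : ρ ≠ 0 := by
    intro h; have := (Complex.cpow_eq_zero_iff _ _).mp h; norm_num at this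
  have ht0 : t ≠ 0 := by
    intro h; have := (Complex.cpow_eq_zero_iff _ _).mp h; norm_num at this
  have ha0 : a ≠ 0 := Complex.ofReal_ne_zero.mpr (Real.rpow_pos_of_pos (by exact_mod_cast Nat.pos_of_ne_zero hA₁0) _).ne'
  have htρ : t * ρ = 3 := cpow_quarter_mul_cpow_quarter (by omega)
  have hcC : (c : ℂ) ≠ 0 := Complex.ofReal_ne_zero.mpr hc0
  have hM : (M' : ℂ) ≠ 0 := Nat.cast_ne_zero.mpr (NeZero.ne M')
  have key : ((8 * M' * s₀ : ℕ) : ℂ) * (τ * ((1 / 4 : ℂ) * (((3 * M' : ℕ) : ℂ)⁻¹ * T)) / ((c : ℂ) * (ϖ * (t * a)⁻¹))) =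
      ((2 : ℂ) / c) * τ * a * ((s₀ : ℂ) * T / (ϖ * ρ)) := by
    push_cast
    field_simp
    linear_combination (8 * (s₀ : ℂ) * τ * T) * htρ
  rw [key]
  exact ((hcint.mul (StarredOptimalManinUnitFiveSevenValueExit.isIntegral_gaussSum χ)).mul
    (isIntegral_rpow_quarter A₁)).mul hX

end Summit.BirchSwinnertonDyer.BirchSwinnertonDyer.Theorems.InertBadSignedBranchesInertBadAtThreeQuarticCleanAssembly

end
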